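import Summits.QuantumFields.YangMills.Theorems.OneCertifiedCubeCrossoverCertificateOpenness

/-!
# Skeleton (line `registered`, reshaped v2) for crux `CrossoverCertificate` (stmt-QuantumFields-16125) — `Lines/birth.lean`

Lead: `prover-line-stmt-QuantumFields-16125-0` (route `route-QuantumFields-OneCertifiedCube`), 2026-08-17.
Reshape v2 = the BC3 birth skeleton of `planner-skel-stmt-QuantumFields-16125-0` with its vocabulary and glue
MOVED INTO THE TREE (landed, sorry-free) and imported instead of restated; the two registered stubs and the
composition are byte-identical in statement:

* vocabulary `influenceSet`, `influence` (`Θ(ρ, β, b, n) = sup` of all TV boundary influences — VERBATIM the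
  binders of the crux's finite-size condition), `0 ≤ Θ ≤ 2`, bridge `finiteSize_iff_influence_le`,
  `crossoverCertificate_iff` — `Theorems/OneCertifiedCubeCrossoverCertificateDefs.lean` (p146591);
* openness glue `eventually_influence_le_of_tendsto_of_frequently`, the hypothesis-form composition
  `crossoverCertificate_of_influenceConverges_of_limitCertificate`, `limitCertificate_of_crossoverCertificate`
  (crux ⇒ value leg), `crossoverCertificate_iff_limsup` (crux = `limsup_k Θ_k(ℓ,n) < 1/M(n)` at one scale),
  `limitCertificate_iff_liminf` (value leg = `liminf` form) — `Theorems/OneCertifiedCubeCrossoverCertificateOpenness.lean` (p148867);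
* UV-leg structure `stub_influenceConverges_of_jointLimit` (stub 1 ⇐ scheme-free joint limit of `Θ(ρ, β, b, n)` as
  `(β, b) → ∞`), `influence_limits_agree_of_stub` (∀-sch stub 1 ⇒ scheme-independence of `lim Θ_k` for schemes
  sharing `(r, T)`) — `Theorems/OneCertifiedCubeCrossoverCertificateUVLeg.lean` (p148882).

The cut (unchanged): crux = `limsup < 1/M(n)` ⇐ (stub 1: `lim` exists at every `(ℓ, n)`) ∧ (stub 2: `liminf < 1/M(n)`
at one `(ℓ, n)`).  Stubs open: `stub_influenceConverges` (UV leg, XL), `stub_limitCertificate` (value leg = the crux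
with `limsup` replaced by `liminf`; crux-sized).  See the lead's NOTES.md `## Census` for the diagnosis.
-/

noncomputable section

namespace Summit.QuantumFields.YangMills.Cruxes.CrossoverCertificate.Birth

open MeasureTheory Filter Topology
open Literature.MathematicalPhysics.QuantumFieldTheory
open Literature.MathematicalPhysics.QuantumLattice

/-- **Stub 1 — `InfluenceConverges` (the UV leg).** Along every weak-coupling scheme that IS a non-trivial
non-Gaussian Yang–Mills continuum limit, at every physical length `ℓ > 0` and shell parameter `n ≥ 1` the TV
influence functional of the fine Wilson specification at cell size `b_k = ⌈ℓ/a_k⌉` HAS A LIMIT as `k → ∞`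
(no value claimed). -/
theorem stub_influenceConverges :
    ∀ (G : Type) [Group G] [TopologicalSpace G] [IsTopologicalGroup G] [CompactSpace G] [MeasurableSpace G]
      [BorelSpace G], IsCompactSimpleLieGroup G → ∀ (r : LatticeRep G) (sch : SpeciesScheme (YMSpecies G))
      (T : OSData (YMSpecies G) 4), sch.HasWeakCouplingLimit → IsYangMillsFor r sch T →
      T.IsNontrivial r.curvature → T.IsNonGaussian r.curvature →
      ∀ ℓ : ℝ, 0 < ℓ → ∀ n : ℕ, 1 ≤ n →
        ∃ θ : ℝ, Tendsto (fun k : ℕ => influence r.ρ (sch.β k) ⌈ℓ / sch.a k⌉₊ n) atTop (𝓝 θ) := by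
  sorry

/-- **Stub 2 — `LimitCertificate` (the non-perturbative leg: the certified value).** Along every such scheme there
are ONE physical length `ℓ > 0`, a shell parameter `n ≥ 1` and a margin `θ` with `θ · M(n) < 1`,
`M(n) = (4n+3)⁴ − (4n+1)⁴`, such that the one-cube certificate `Θ(r.ρ, β_k, ⌈ℓ/a_k⌉, n) ≤ θ` holds on ARBITRARILY
FINE lattices of the scheme (for infinitely many `k`); equivalently (`limitCertificate_iff_liminf`)
`liminf_k Θ_k(ℓ, n) < 1/M(n)` at one scale. -/
theorem stub_limitCertificate :
    ∀ (G : Type) [Group G] [TopologicalSpace G] [IsTopologicalGroup G] [CompactSpace G] [MeasurableSpace G]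
      [BorelSpace G], IsCompactSimpleLieGroup G → ∀ (r : LatticeRep G) (sch : SpeciesScheme (YMSpecies G))
      (T : OSData (YMSpecies G) 4), sch.HasWeakCouplingLimit → IsYangMillsFor r sch T →
      T.IsNontrivial r.curvature → T.IsNonGaussian r.curvature →
      ∃ ℓ : ℝ, 0 < ℓ ∧ ∃ (n : ℕ) (θ : ℝ), 1 ≤ n ∧ θ * ((((4 * n + 3) ^ 4 - (4 * n + 1) ^ 4 : ℕ)) : ℝ) < 1 ∧
        ∃ᶠ k : ℕ in atTop, influence r.ρ (sch.β k) ⌈ℓ / sch.a k⌉₊ n ≤ θ := by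
  sorry

/-- **Composition** — the crux BY NAME from the two stubs BY NAME, through the landed hypothesis-form composition
`crossoverCertificate_of_influenceConverges_of_limitCertificate` (openness file). -/
theorem CrossoverCertificate_of :
    Summit.QuantumFields.YangMills.Theses.OneCertifiedCube.CrossoverCertificate :=
  crossoverCertificate_of_influenceConverges_of_limitCertificate stub_influenceConverges stub_limitCertificate

/-- Signature match (kernel-checked): the composition inhabits the crux decl by name. -/
example : Summit.QuantumFields.YangMills.Theses.OneCertifiedCube.CrossoverCertificate := CrossoverCertificate_of

end Summit.QuantumFields.YangMills.Cruxes.CrossoverCertificate.Birth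

end
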